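import Summits.QuantumFields.BalabanUV.Beta.D1BFx.CoframeMassUniform
import Summits.QuantumFields.BalabanUV.Beta.D1BFx.PackedCoframeMassRoad

/-!
# `BalabanUV.Beta.D1BFx.CoframeTableMassScales` — road «BF-x» for BINDER row D1, slot (K): **THE (C2) ROW «TB4-W CO-FRAME TABLE,
# m-UNIFORM MASS» ON THE SCALES `n = L^k` AS A THEOREM** — the objects-side junction of gan24-leaf-05's m-uniform letter
# `CoframeMassUniform.exists_totMass_cofPairInf_uniform` (δ4b) with the road's END (PART 14 `RoadEndBFxRoadScalesS`, binders `hκc hCs' hCm`)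

HONEST DEPENDENCY (page 1, mandatory): continuum YM on T⁴ ⇐ BetaPertH ∧ nine spine estimates (0/9 proved); BetaPertH ⇐ (D1) ∧ (D4) ∧
CAP+tail; G-an2-4 gates asym, D1 and NE2/3/4.  HONEST FRAMING (cell contract, verbatim): «discharging `BetaPertH` makes Bałaban's UV
stability UNCONDITIONAL — a real constructive-QFT result; it is NOT the continuum limit and NOT the Clay problem.»  THIS FILE DISCHARGES
NOTHING of D1 / BetaPertH and closes NO binder of the spine root: it proves the two DISPLAYED (C2) hypotheses `hCs' ∕ hCm` of the road's
END (with the rate `κc` and the constants `mC` as witnesses) for the road's per-scale roots `r (L^k)`.  The analytic content is ENTIRELY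
gan24-leaf-05 g54's (δ4b over γ1–γ3, δ1–δ4a: lit-balaban's lattice potential theory + `ℓ¹` bookkeeping, kernel-checked); this file is
[folklore] plumbing over this lineage's OWN objects (`PackedCoframeMassRoad.blk_embFF`: the co-frame table sits in the field∕field block of
`embFF`, the other three blocks are `0`) and the `[NeZero N]` re-indexing that lets a letter stated at `m + 1 = L^k` be read at `L^k`
(instances agree by proof irrelevance; cf. leaf-01 g24's `PackedRoadRowsPow`).  (C1) is the sibling file `CoframeJetMassScales`.  The
junctions (J1)(J2)(J3) are untouched; (K) NOT closed; 0∕4 row-D1 binders discharged; NOT D1, NOT BetaPertH, NOT continuum, NOT Clay.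

WHAT IS HERE (unit `b2b-balaban-beta-d1-formalise-leaf-03`, gen 25; ruling ρ-g19-1 amended: objects = leaf-03, count = gan24-leaf-05;
gan24-leaf-05 INTENT-6 CLAIMS.log l.44867: «the junction … is theirs to re-run on this letter»):
* §1 `box_of_succ` (the road's root family `r` at any `[NeZero N]`), `totMass_cofPairInf_at` (δ4b's letter read at an arbitrary `[NeZero N]`
  with `N = L^k`), `blk_embFF_mass` (block masses of `embFF K` from `TotMass K M`).
* §2 **`exists_C2_letters (hL : 2 ≤ L) (ha : 0 < a) (hr : ∀ m, r (m+1) ∈ box (3+1) (m+1)) (μ ν) :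
  ∃ κc > 0, ∃ mC, ∀ k ≥ 1, ∀ z j i, (Summable fun q ↦ Σ g, Σ f, |blk (embFF (cofPairInf (L^k) a (colH G₀ (L^k) μ 0) (colH G₀ (L^k) ν z))) j i q.1 q.2 g f|)
  ∧ Σ' … ≤ mC j i·e^{−κc|z|₁}`** (`G₀ = coDressKBmAt (toSite (r (L^k))) (L^k) (KInvStep (L^k) 0)`) — EXACTLY PART 14's `hCs' ∕ hCm`;
  witnesses `κc := θ₁`, `mC j i := KN` (δ4b's).

No `def`, no `def … : Prop`, nothing cited as mathematics.
-/

noncomputable section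

namespace Summit.QuantumFields.BalabanUV.Beta.D1BFx.CoframeTableMassScales

open scoped BigOperators
open Literature.MathematicalPhysics.QuantumFieldTheory.Balaban1983to89
open Literature.MathematicalPhysics.QuantumFieldTheory.Balaban1983to89.Beta
open B12Sec2to5 (l1 l1_nonneg)
open ExpKernelCalculus (Site MKer l1_sub_symm)
open AffineAveraging (box toSite)
open OneStepKernelFamily (colH KInvStep)
open Summit.QuantumFields.BalabanUV.Beta.AxialDressingRooted (coDressKBmAt)
open Summit.QuantumFields.BalabanUV.Beta.D1BFx.PackedKernelSplit (blk)
open Summit.QuantumFields.BalabanUV.Beta.D1BFx.PackedSortedBridges (embFF)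
open Summit.QuantumFields.BalabanUV.Beta.D1BFx.PackedCoframePairLimit (cofPairInf)
open Summit.QuantumFields.BalabanUV.Beta.D1BFx.PackedCoframeMassRoad (blk_embFF)
open Summit.QuantumFields.BalabanUV.Beta.D1BFx.KernelMassCalculus (TotMass)
open Summit.QuantumFields.BalabanUV.Beta.D1BFx.CoframeMassUniform (exists_totMass_cofPairInf_uniform)

/-! ## §1 Re-indexing and block read-outs -/

/-- [folklore] The road's per-scale root family at any positive scale. -/
theorem box_of_succ {r : ℕ → Fin (3 + 1) → ℕ} (hr : ∀ m : ℕ, r (m + 1) ∈ box (3 + 1) (m + 1)) (N : ℕ) [NeZero N] :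
    r N ∈ box (3 + 1) N := by
  obtain ⟨M, rfl⟩ : ∃ M, N = M + 1 := ⟨N - 1, (Nat.succ_pred_eq_of_ne_zero (NeZero.ne N)).symm⟩
  exact hr M

/-- [folklore] **δ4b's LETTER READ AT AN ARBITRARY POSITIVE SCALE `N = L^k`** (the `NeZero` instances at `N` and at `M + 1` agree by proof
irrelevance after `obtain ⟨M, rfl⟩`). -/
theorem totMass_cofPairInf_at {a : ℝ} {L k : ℕ} {KN θ₁ : ℝ}
    (H : ∀ (m : ℕ), m + 1 = L ^ k → ∀ (rr : Fin (3 + 1) → ℕ), rr ∈ box (3 + 1) (m + 1) → ∀ (μ ν : Fin 4) (y y' : Fin 4 → ℤ),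
      TotMass (cofPairInf (m + 1) a (colH (coDressKBmAt (toSite rr) (m + 1) (KInvStep (d := 3) (m + 1) 0)) (m + 1) μ y)
        (colH (coDressKBmAt (toSite rr) (m + 1) (KInvStep (d := 3) (m + 1) 0)) (m + 1) ν y')) (KN * Real.exp (-θ₁ * l1 (y - y'))))
    (N : ℕ) [NeZero N] (hN : N = L ^ k) {rr : Fin (3 + 1) → ℕ} (hrr : rr ∈ box (3 + 1) N) (μ ν : Fin 4) (y y' : Fin 4 → ℤ) :
    TotMass (cofPairInf N a (colH (coDressKBmAt (toSite rr) N (KInvStep (d := 3) N 0)) N μ y)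
      (colH (coDressKBmAt (toSite rr) N (KInvStep (d := 3) N 0)) N ν y')) (KN * Real.exp (-θ₁ * l1 (y - y'))) := by
  obtain ⟨M, rfl⟩ : ∃ M, N = M + 1 := ⟨N - 1, (Nat.succ_pred_eq_of_ne_zero (NeZero.ne N)).symm⟩
  exact H M hN rr hrr μ ν y y'

/-- [folklore] **THE BLOCK MASSES OF `embFF K`** from the total mass of `K`: the field∕field block carries `K`, the other three blocks are
`0` (`PackedCoframeMassRoad.blk_embFF`); constant `M` for all four (it is `≥ 0`). -/
theorem blk_embFF_mass {K : MKer 4 (Fin 4)} {M : ℝ} (h : TotMass K M) (j i : Bool) :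
    (Summable fun q : Site 4 × Site 4 => ∑ g, ∑ f, |blk (embFF K) j i q.1 q.2 g f|) ∧
      ∑' q : Site 4 × Site 4, ∑ g, ∑ f, |blk (embFF K) j i q.1 q.2 g f| ≤ M := by
  have hM : 0 ≤ M := (tsum_nonneg fun q => Finset.sum_nonneg fun g _ => Finset.sum_nonneg fun f _ => abs_nonneg _).trans h.2
  rw [blk_embFF]
  by_cases hji : j = true ∧ i = true
  · rw [if_pos hji]; exact h
  · rw [if_neg hji]
    have e : (fun q : Site 4 × Site 4 => ∑ g : Fin 4, ∑ f : Fin 4, |(0 : MKer 4 (Fin 4)) q.1 q.2 g f|) = fun _ => 0 := by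
      funext q; simp
    rw [e, tsum_zero]
    exact ⟨summable_zero, hM⟩

/-! ## §2 The (C2) row on the scales -/

/-- [folklore] **THE (C2) ROW «TB4-W CO-FRAME TABLE, m-UNIFORM MASS» ON THE SCALES, AS A THEOREM.**  For `L ≥ 2`, `a > 0` and the road's
per-scale roots `r`, one rate `κc > 0` and one table of constants `mC` serve EVERY scale `n = L^k`: the block masses of the embedded
co-frame pair table at the base bond `(μ, 0)` against the column `(ν, z)` decay like `e^{−κc|z|₁}` — EXACTLY PART 14's `hCs' ∕ hCm`. -/
theorem exists_C2_letters {L : ℕ} [NeZero L] (hL : 2 ≤ L) {a : ℝ} (ha : 0 < a) {r : ℕ → Fin (3 + 1) → ℕ}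
    (hr : ∀ m : ℕ, r (m + 1) ∈ box (3 + 1) (m + 1)) (μ ν : Fin 4) :
    ∃ κc : ℝ, 0 < κc ∧ ∃ mC : Bool → Bool → ℝ, ∀ (k : ℕ), 1 ≤ k → ∀ (z : Site 4) (j i : Bool),
      (Summable fun q : Site 4 × Site 4 => ∑ g, ∑ f,
        |blk (embFF (cofPairInf (L ^ k) a (colH (coDressKBmAt (toSite (r (L ^ k))) (L ^ k) (KInvStep (d := 3) (L ^ k) 0)) (L ^ k) μ 0)
          (colH (coDressKBmAt (toSite (r (L ^ k))) (L ^ k) (KInvStep (d := 3) (L ^ k) 0)) (L ^ k) ν z))) j i q.1 q.2 g f|) ∧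
      ∑' q : Site 4 × Site 4, ∑ g, ∑ f,
        |blk (embFF (cofPairInf (L ^ k) a (colH (coDressKBmAt (toSite (r (L ^ k))) (L ^ k) (KInvStep (d := 3) (L ^ k) 0)) (L ^ k) μ 0)
          (colH (coDressKBmAt (toSite (r (L ^ k))) (L ^ k) (KInvStep (d := 3) (L ^ k) 0)) (L ^ k) ν z))) j i q.1 q.2 g f|
          ≤ mC j i * Real.exp (-κc * l1 z) := by
  obtain ⟨KN, θ₁, hθ₁, H⟩ := exists_totMass_cofPairInf_uniform (a := a) hL ha
  refine ⟨θ₁, hθ₁, fun _ _ => KN, fun k hk z j i => ?_⟩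
  have key := totMass_cofPairInf_at (H k hk) (L ^ k) rfl (box_of_succ hr (L ^ k)) μ ν 0 z
  rw [l1_sub_symm, sub_zero] at key
  exact blk_embFF_mass key j i

end Summit.QuantumFields.BalabanUV.Beta.D1BFx.CoframeTableMassScales

end
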